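import Summits.CriticalPhenomena.CardyFormulaZ2.Theses.CardyTensorRG
import Summits.CriticalPhenomena.CardyFormulaZ2.Theorems.CardyTensorRGPolyominoToJordanStubLowerPolyominoSandwich
import Summits.CriticalPhenomena.CardyFormulaZ2.Theorems.CardyTensorRGPolyominoToJordanStubUpperPolyominoSandwich

/-!
# `PolyominoToJordan` — crossing-limit laws for polyomino quads extend to all conformal rectangles

Crux `Summit.CriticalPhenomena.CardyFormulaZ2.Theses.CardyTensorRG.PolyominoToJordan`
(stmt-CriticalPhenomena-14338, route `CardyTensorRG`, sub-problem `CriticalPhenomena/CardyFormulaZ2`)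
CLOSED by line `registered` (birth skeleton `Cruxes/PolyominoToJordan/Lines/birth.lean`):

  `PolyominoToJordan := ∀ F continuous on (0,1), (every POLYOMINO conformal rectangle — interior of
  a finite union of closed δ₀-squares, marks at δ₀-lattice points — has bond-ℤ² crossing limit
  F(cross-ratio)) → every conformal rectangle has bond-ℤ² crossing limit F(cross-ratio)`.

The two landed stubs (both `F`-free):
* `stub_lowerPolyominoSandwich` (`Theorems/CardyTensorRGPolyominoToJordanStubLowerPolyominoSandwich.lean`):
  a polyomino quad `P⁻` with modulus `ε`-close to that of `R` and `bond P⁻ δ ≤ bond R δ + ε`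
  eventually — the lower half of the tree's construction-free Bollobás–Riordan sandwich with a
  lattice-polygon comparison domain, modulus by Radó continuity in `ε`-form;
* `stub_upperPolyominoSandwich` (`Theorems/CardyTensorRGPolyominoToJordanStubUpperPolyominoSandwich.lean`):
  a polyomino quad `P⁺` with modulus `ε`-close and `bond R δ ≤ bond P⁺ δ + ε` eventually — the
  flip-free upper half: square model respecting the corners, wider–shorter perturbation in mixed
  position above the quad (`stub_upperSandwichOfArcs`, the tree's `exists_upper_sandwich` with
  approximately matched arcs), lattice-polygon approximant, Radó.
* `PolyominoToJordan_proof` — the registered composition `PolyominoToJordan_of` of the skeleton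
  with the stubs plugged in (kernel-checked): continuity of `F` at `η = crossRatio x ∈ (0,1)`
  turns the modulus clauses into `|F(η_{P^∓}) - F(η)| < e/3`, the hypothesis on the polyomino
  quads gives `bond P^∓ δ → F(η_{P^∓})`, and the two one-sided comparisons squeeze `bond R δ`
  into `(F(η) - e, F(η) + e)` eventually.

No symmetry `F(1-η) = 1 - F(η)` is used (the crux's "why it might fail"): the upper bound comes
from a genuine upper comparison domain, not from the lower bound for the conjugate marking.

References: B. Bollobás, O. Riordan, *Percolation* (2006), Ch. 7 Lemma 14, Claims 19–20, remark
p. 195; O. Schramm, S. Smirnov, Ann. Probab. 39 (2011), Lemma 5.1; Ch. Pommerenke (1992) Thm 2.11.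
-/

noncomputable section

open Set Filter Topology Metric
open UpperHalfPlane (upperHalfPlaneSet)
open Literature.Probability.RandomPlanarGeometry
open Literature.Probability.Percolation (bondDomainCrossingProb)

namespace Summit.CriticalPhenomena.CardyFormulaZ2.Cruxes.PolyominoToJordan.Birth

/-- **`PolyominoToJordan`** (crux stmt-CriticalPhenomena-14338 of route `CardyTensorRG`) — the
registered composition `PolyominoToJordan_of` of line `registered` with its two hypotheses
instantiated by the landed stubs `stub_lowerPolyominoSandwich`, `stub_upperPolyominoSandwich`:
the two polyomino sandwiches imply the crux for EVERY `F` continuous on `(0,1)`.  Given `R`,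
`(φ, x)` and `e > 0`: continuity of `F` at `η = crossRatio x ∈ (0,1)` gives `τ`; the stubs at
`ε = min (τ/2) (e/3)` give polyomino quads `P⁻, P⁺` with `|F(η_{P^∓}) - F(η)| < e/3`; the
hypothesis on polyomino quads gives `bond P^∓ δ → F(η_{P^∓})`; hence eventually
`F(η) - e < bond P⁻ δ - ε ≤ bond R δ ≤ bond P⁺ δ + ε < F(η) + e`.
[cite: BollobasRiordan2006, Ch. 7 Lemma 14 p. 184, Claims 19–20 p. 192, remark p. 195] -/
theorem PolyominoToJordan_proof :
    Summit.CriticalPhenomena.CardyFormulaZ2.Theses.CardyTensorRG.PolyominoToJordan := by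
  intro F hF hpoly R φ x hux
  -- the modulus of `R` lies in `(0,1)`, where `F` is continuous
  have hη : crossRatio x ∈ Ioo (0 : ℝ) 1 :=
    ConformalRectangle.crossRatio_mem_Ioo_of_isUniformizing hux
  have hFat : ContinuousAt F (crossRatio x) := hF.continuousAt (Ioo_mem_nhds hη.1 hη.2)
  rw [Metric.tendsto_nhds]
  intro e he
  obtain ⟨τ, hτ, hτF⟩ := Metric.continuousAt_iff.1 hFat (e / 3) (by positivity)
  have hε : 0 < min (τ / 2) (e / 3) := lt_min (by positivity) (by positivity)
  have hε₁ : min (τ / 2) (e / 3) < τ := (min_le_left _ _).trans_lt (by linarith)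
  have hε₂ : min (τ / 2) (e / 3) ≤ e / 3 := min_le_right _ _
  -- LOWER: a polyomino quad crossed at most `ε` more often than `R`, modulus `ε`-close
  have hlo : ∀ᶠ δ : ℝ in 𝓝[>] 0, F (crossRatio x) - e < bondDomainCrossingProb R δ := by
    obtain ⟨P, hPpoly, ⟨ψ, y, hψ, hmod⟩, hcmp⟩ := stub_lowerPolyominoSandwich R φ x hux _ hε
    have hFy : dist (F (crossRatio y)) (F (crossRatio x)) < e / 3 :=
      hτF (by rw [Real.dist_eq]; exact hmod.trans_lt hε₁)
    rw [Real.dist_eq, abs_sub_lt_iff] at hFy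
    have hPlim : Tendsto (bondDomainCrossingProb P) (𝓝[>] 0) (𝓝 (F (crossRatio y))) :=
      hpoly P hPpoly ψ y hψ
    have hev : ∀ᶠ δ : ℝ in 𝓝[>] 0, F (crossRatio y) - e / 3 < bondDomainCrossingProb P δ :=
      hPlim.eventually (lt_mem_nhds (by linarith))
    filter_upwards [hev, hcmp] with δ h1 h2
    linarith [hFy.1, hFy.2]
  -- UPPER: a polyomino quad crossed at least as often as `R` up to `ε`, modulus `ε`-close
  have hhi : ∀ᶠ δ : ℝ in 𝓝[>] 0, bondDomainCrossingProb R δ < F (crossRatio x) + e := by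
    obtain ⟨P, hPpoly, ⟨ψ, y, hψ, hmod⟩, hcmp⟩ := stub_upperPolyominoSandwich R φ x hux _ hε
    have hFy : dist (F (crossRatio y)) (F (crossRatio x)) < e / 3 :=
      hτF (by rw [Real.dist_eq]; exact hmod.trans_lt hε₁)
    rw [Real.dist_eq, abs_sub_lt_iff] at hFy
    have hPlim : Tendsto (bondDomainCrossingProb P) (𝓝[>] 0) (𝓝 (F (crossRatio y))) :=
      hpoly P hPpoly ψ y hψ
    have hev : ∀ᶠ δ : ℝ in 𝓝[>] 0, bondDomainCrossingProb P δ < F (crossRatio y) + e / 3 :=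
      hPlim.eventually (gt_mem_nhds (by linarith))
    filter_upwards [hev, hcmp] with δ h1 h2
    linarith [hFy.1, hFy.2]
  filter_upwards [hlo, hhi] with δ h1 h2
  rw [Real.dist_eq, abs_sub_lt_iff]
  constructor <;> linarith

end Summit.CriticalPhenomena.CardyFormulaZ2.Cruxes.PolyominoToJordan.Birth

end
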